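import Summits.BirchSwinnertonDyer.BirchSwinnertonDyer.Theorems.PrintCf2RamifiedOffTYZSecondNormLawsValue
import Literature.NumberTheory.EllipticCurves.XZeroThirtyTwoEtaCoordinates
import Literature.NumberTheory.ComplexMultiplication.ShimuraReciprocityExtendedRingClass
import HarnessLib

/-!
# THE RE-CUT OF C⁺ WITH THEOREM A'S PRINT INPUTS THREADED: «THEOREM A for the CM realisation, granted 𝔅_ram, its three print facts and
# `ord_{s=1} L(E_n,s) = 1`» + «second-norm law» + remainder ⟹ C⁺ — the kernel composition of skeleton v12 of crux stmt-BirchSwinnertonDyer-20509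
# (`RamifiedOffTYZOfFacts`, line `offtyz-v7`, LEAD cruxlead-20509 g32, cycle 33, part 3)

HONEST FRAMING (cell `bsd-print-cf2`, route `PrintCf2`; `--supports stmt-BirchSwinnertonDyer-20509`; theorems only, `def`-free, no `sorry`, no named
fact introduced).  BSD is not proved by any of this; no class is closed by this file; item 23431 (C⁺) and crux 20509 stay OPEN.  «THEOREM A» (`hA`),
«SECOND-NORM LAW» (`hS`), «REMAINDER» (`hO`) and the print bundle `hP` are HYPOTHESES (spelled inline / by name), as a skeleton composition consumes stubs.

WHY THIS FILE (v11 → v12).  In v10/v11 the stub THEOREM A (`stub_offTYZ_firstNormSquare_R2`) had NO fact among its antecedents, although its proof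
(g29 memo `Lines/offtyz_v7_ExactDescent.md` §2; this cycle's road memo `Lines/offtyz_v7_TheoremARoad.md`) consumes PRINTED results that the tree
holds only as named facts (`def … : Prop`, no `_holds`): it was not closable in the kernel even in principle.  v12 threads them: THEOREM A now reads
«𝔅_ram → (`x032_φ_eq_etaQuotient ∧ x032_φ_injective ∧ Cox2013.cox2013_shimuraReciprocity_rayClassField`) → ∀ l q n …, `ord_{s=1} L(E_n, s) = 1` →
∀ package, ∀ realisation with (S1)–(S4), `N₁` is a square», where
* `x032_φ_eq_etaQuotient` / `x032_φ_injective` (`Literature/…/XZeroThirtyTwoEtaCoordinates.lean`, p811081 / rev 2; Yang 2006 §4.1 Table row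
  `N = 32`: `x∘i₀ = η₁₆⁶/(η₈²η₃₂⁴) = s²`, `(X,Y) : X₀(32) ⥲ A`),
* `cox2013_shimuraReciprocity_rayClassField` (`Literature/…/ComplexMultiplication/ShimuraReciprocityExtendedRingClass.lean`, p809658; Cox Thm 15.16–15.17),
* 𝔅_ram supplies conjunct 7 (Rédei–Reichardt: `4 ∣ h(−lq) ⟺ (l/q) = 1`, the evenness of `g(n)`) and conjuncts 1, 5 (with `ord L = 1`: `Z(lq)` is not
  torsion, p802477, so the exact-descent class `[N₁] = κ⁰(Z)` is realisation-independent),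
and the transfer step is this cycle's kernel file `PrintCf2RamifiedOffTYZHalfNormTransfer.lean` (p810950).  The three facts enter the skeleton through ONE
print door `stub_offTYZ_theoremAPrints` (width 0, like the TYZ display door).  THIS FILE is the v12 composition: p810804's §2 with `hA`
taking `ord_{s=1} L(E_n,s) = 1` (available at the consumer; the row theorem is p810804's §1 by name) — the bundle and the print door are applied to the stub by the skeleton before the call.

References: [cite: TianYuanZhang2017, §1, §3.1, §3.2, Thm. 3.5, Lemma 3.18, Thm. 1.2]; [cite: Yang2006DefiningEquations, §4.1 Table row N = 32];
[cite: Cox2013, Thm. 15.16, Thm. 15.17]; [cite: BurungaleFlach2024, Thm 1.1 / Cor. 3]; [cite: Darmon2004, Thm. 3.22]; [cite: SilvermanAEC2009, Thm. X.1.1, Prop. X.1.4];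
[cite: NeukirchSchmidtWingberg2008, §1.5]; tree: p802477, p802722, p803014, p810804, p810950, p811081.
-/

noncomputable section

open scoped Classical

open WeierstrassCurve WeierstrassCurve.Affine WeierstrassCurve.Affine.Point
  Literature.NumberTheory.EllipticCurves Literature.NumberTheory.EllipticCurves.Rank1Residual
  Summit.BirchSwinnertonDyer.Rank1Residual
  Literature.NumberTheory.EllipticCurves.TianYuanZhang2017
  Literature.NumberTheory.EllipticCurves.TianYuanZhang2017.W2
  Summit.BirchSwinnertonDyer.PrintCf2.VisibleGenerator

set_option autoImplicit false

namespace Summit.BirchSwinnertonDyer.PrintCf2.SecondNormLawsPrints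

variable {n : ℕ}

open Literature.NumberTheory.EllipticCurves.TianYuanZhang2017.GenusPointData (galPtOver)

/-! ## The whole text of C⁺ from the four pieces, THEOREM A guarded by `ord_{s=1} L(E_n,s) = 1` (the composition of skeleton v12) -/

/-- ★★★★ **C⁺ = `RamifiedJumpOneLevelTwoOfFacts` VERBATIM from: 𝔅_ram, the value display fact `tyz_sevenBlockCMValueData`, «THEOREM A on R2 for
the CM realisation» (`hA`), «𝔅_ram → SECOND-NORM LAW on the visible R2 class rows for the CM realisation» (`hS`) and «𝔅_ram → C⁺ off the visible R2
rows» (`hO`).**  The case split «visible R2 row or not» is decidable bookkeeping; on a visible R2 row p810804 §1 applies with conjuncts 1, 2, 4, 5 of 𝔅_ram.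
`hA` is THEOREM A with the analytic-rank guard (skeleton v12 obtains it from `stub_offTYZ_firstNormSquare_R2` by applying 𝔅_ram and the print door).  This is the sorry-free term by which skeleton v12 DERIVES the stub `stub_offTYZ_levelTwoScriptLExact` from its re-cut stubs.
[cite: TianYuanZhang2017, §1, §3.1, §3.2, Thm. 3.5, Lemma 3.18, Thm. 1.2] [cite: BurungaleFlach2024, Thm 1.1 / Cor. 3] [cite: Darmon2004, Thm. 3.22]
[cite: SilvermanAEC2009, Thm. X.1.1, Prop. X.1.4] [cite: NeukirchSchmidtWingberg2008, §1.5] [cite: EdixhovenManin1991, §1] -/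
theorem levelTwoScriptLExact_of_laws_prints
    (hB : (Literature.NumberTheory.EllipticCurves.rank_eq_analyticRank_of_analyticRank_le_one ∧ WeierstrassCurve.hasEntireLFunction_rat ∧ WeierstrassCurve.bsdRHS_eq_of_isIsogenous ∧ Literature.NumberTheory.EllipticCurves.bsdTriple_of_hasCM_of_L_one_ne_zero ∧ Literature.NumberTheory.EllipticCurves.TianYuanZhang2017.thm12_parity_of_scriptL' ∧ Literature.NumberTheory.EllipticCurves.Tian2014.thm13_rank_one_and_sha_odd ∧ Literature.NumberTheory.QuadraticFields.RedeiReichardt.redeiReichardt_fourTwoCard_classGroup ∧ Literature.NumberTheory.EllipticCurves.LiLiuTian2024.thm12_bsd_congruentNumberCurve ∧ Literature.NumberTheory.EllipticCurves.Monsky1990.cor515_rank_eq_one_and_card_selmerGroup_two ∧ Literature.NumberTheory.EllipticCurves.HeathBrown1994.monsky_card_selmerGroup_two_even ∧ Literature.NumberTheory.EllipticCurves.Tian2014.tian2014_system_sMinus_genus))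
    (hT : tyz_sevenBlockCMValueData)
    (hA : ∀ (l q n : ℕ), l.Prime → q.Prime → l % 8 = 1 → q % 8 = 7 → IsSquare ((l : ℤ) : ZMod q) → n = l * q →
      (congruentNumberCurve n).analyticRank = 1 →
      ∀ (D : GenusPointData n), D.Printed → D.CMPointCompositumPrinted → D.Thm35AtBlocks →
      ∀ (M : Type) (_ : Field M) (_ : NumberField M) (_ : IsGalois ℚ M) (ι : D.H →ₐ[ℚ] M) (x₀ y₀ : M)
        (h₀ : (curveA.baseChange M).toAffine.Nonsingular x₀ y₀) (Φ : Finset (M ≃ₐ[ℚ] M)),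
        (Point.map (W' := curveA) ι (D.Z n) = ∑ t ∈ Φ, galPtOver M t (.some x₀ y₀ h₀) ∧ Φ.card = gK n) →
        (∀ t ∈ Φ, ¬ ((2 : ℕ) • galPtOver M t (.some x₀ y₀ h₀) = 0 ∨ (2 : ℕ) • galPtOver M t (.some x₀ y₀ h₀) = tauOne)) →
        (∀ g : M ≃ₐ[ℚ] M, D.TrivialOnLOver ι n g →
          ∃ π : Φ → Φ, Function.Bijective π ∧
            ∀ t : Φ, galPtOver M g (galPtOver M (t : M ≃ₐ[ℚ] M) (.some x₀ y₀ h₀)) = galPtOver M (π t : M ≃ₐ[ℚ] M) (.some x₀ y₀ h₀)) →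
        SevenBlockCMValue (.some x₀ y₀ h₀) n →
        ∀ N₁ : D.H, ι N₁ = ∏ t ∈ Φ, (t : M ≃ₐ[ℚ] M) x₀ → ∃ r : D.H, N₁ = r ^ 2)
    (hS : (Literature.NumberTheory.EllipticCurves.rank_eq_analyticRank_of_analyticRank_le_one ∧ WeierstrassCurve.hasEntireLFunction_rat ∧ WeierstrassCurve.bsdRHS_eq_of_isIsogenous ∧ Literature.NumberTheory.EllipticCurves.bsdTriple_of_hasCM_of_L_one_ne_zero ∧ Literature.NumberTheory.EllipticCurves.TianYuanZhang2017.thm12_parity_of_scriptL' ∧ Literature.NumberTheory.EllipticCurves.Tian2014.thm13_rank_one_and_sha_odd ∧ Literature.NumberTheory.QuadraticFields.RedeiReichardt.redeiReichardt_fourTwoCard_classGroup ∧ Literature.NumberTheory.EllipticCurves.LiLiuTian2024.thm12_bsd_congruentNumberCurve ∧ Literature.NumberTheory.EllipticCurves.Monsky1990.cor515_rank_eq_one_and_card_selmerGroup_two ∧ Literature.NumberTheory.EllipticCurves.HeathBrown1994.monsky_card_selmerGroup_two_even ∧ Literature.NumberTheory.EllipticCurves.Tian2014.tian2014_system_sMinus_genus)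 →
      ∀ (l q n : ℕ), l.Prime → q.Prime → l % 8 = 1 → q % 8 = 7 → IsSquare ((l : ℤ) : ZMod q) → n = l * q →
      (congruentNumberCurve n).analyticRank = 1 →
      Nat.card ((congruentNumberCurve n).selmerGroup 2) = 2 ^ 5 → Nat.card ((congruentNumberCurve n).selmerGroup 4) = 2 ^ 6 →
      (∃ (X Y : ℚ) (h : (Atwo n).toAffine.Nonsingular X Y),
        (∀ P : (Atwo n).toAffine.Point, ∃ m : ℤ, IsOfFinAddOrder (P - m • (Point.some X Y h : (Atwo n).toAffine.Point))) ∧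
          ¬ ∃ s : ℚ, X = 2 * s ^ 2) →
      ∀ (D : GenusPointData n), D.Printed → D.CMPointCompositumPrinted → D.Thm35AtBlocks →
      ∀ (M : Type) (_ : Field M) (_ : NumberField M) (_ : IsGalois ℚ M) (ι : D.H →ₐ[ℚ] M) (x₀ y₀ : M)
        (h₀ : (curveA.baseChange M).toAffine.Nonsingular x₀ y₀) (Φ : Finset (M ≃ₐ[ℚ] M)),
        (Point.map (W' := curveA) ι (D.Z n) = ∑ t ∈ Φ, galPtOver M t (.some x₀ y₀ h₀) ∧ Φ.card = gK n) →
        (∀ t ∈ Φ, ¬ ((2 : ℕ) • galPtOver M t (.some x₀ y₀ h₀) = 0 ∨ (2 : ℕ) • galPtOver M t (.some x₀ y₀ h₀) = tauOne)) →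
        (∀ g : M ≃ₐ[ℚ] M, D.TrivialOnLOver ι n g →
          ∃ π : Φ → Φ, Function.Bijective π ∧
            ∀ t : Φ, galPtOver M g (galPtOver M (t : M ≃ₐ[ℚ] M) (.some x₀ y₀ h₀)) = galPtOver M (π t : M ≃ₐ[ℚ] M) (.some x₀ y₀ h₀)) →
        SevenBlockCMValue (.some x₀ y₀ h₀) n →
        ∀ N₁ N₀ : D.H, ι N₁ = ∏ t ∈ Φ, (t : M ≃ₐ[ℚ] M) x₀ → ι N₀ = ∏ t ∈ Φ, ((t : M ≃ₐ[ℚ] M) x₀ - 2 * ι D.im) →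
          sqClass N₁ = 1 → ¬ ((∃ s : D.H, N₀ = s ^ 2) ∨ ∃ s : D.H, N₀ * D.im = s ^ 2))
    (hO : (Literature.NumberTheory.EllipticCurves.rank_eq_analyticRank_of_analyticRank_le_one ∧ WeierstrassCurve.hasEntireLFunction_rat ∧ WeierstrassCurve.bsdRHS_eq_of_isIsogenous ∧ Literature.NumberTheory.EllipticCurves.bsdTriple_of_hasCM_of_L_one_ne_zero ∧ Literature.NumberTheory.EllipticCurves.TianYuanZhang2017.thm12_parity_of_scriptL' ∧ Literature.NumberTheory.EllipticCurves.Tian2014.thm13_rank_one_and_sha_odd ∧ Literature.NumberTheory.QuadraticFields.RedeiReichardt.redeiReichardt_fourTwoCard_classGroup ∧ Literature.NumberTheory.EllipticCurves.LiLiuTian2024.thm12_bsd_congruentNumberCurve ∧ Literature.NumberTheory.EllipticCurves.Monsky1990.cor515_rank_eq_one_and_card_selmerGroup_two ∧ Literature.NumberTheory.EllipticCurves.HeathBrown1994.monsky_card_selmerGroup_two_even ∧ Literature.NumberTheory.EllipticCurves.Tian2014.tian2014_system_sMinus_genus) →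
      ∀ (n : ℕ) [(congruentNumberCurve n).IsElliptic] [(congruentNumberCurve n).IsGloballyMinimal],
      Squarefree n → (n % 8 = 5 ∨ n % 8 = 6 ∨ n % 8 = 7) →
      (congruentNumberCurve n).analyticRank = 1 →
      Nat.card ((congruentNumberCurve n).selmerGroup 2) = 2 ^ 5 →
      Nat.card ((congruentNumberCurve n).selmerGroup 4) = 2 ^ 6 →
      ¬ ((∃ l q : ℕ, l.Prime ∧ q.Prime ∧ l % 8 = 1 ∧ q % 8 = 7 ∧ IsSquare ((l : ℤ) : ZMod q) ∧ n = l * q) ∧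
          ∃ (X Y : ℚ) (h : (Atwo n).toAffine.Nonsingular X Y),
            (∀ P : (Atwo n).toAffine.Point, ∃ m : ℤ, IsOfFinAddOrder (P - m • (Point.some X Y h : (Atwo n).toAffine.Point))) ∧
              ¬ ∃ s : ℚ, X = 2 * s ^ 2) →
      ∀ L : ℤ, IsScriptL n L → (2 : ℤ) ∣ L ∧ ¬ (4 : ℤ) ∣ L) :
    ∀ (n : ℕ) [(congruentNumberCurve n).IsElliptic] [(congruentNumberCurve n).IsGloballyMinimal],
      Squarefree n → (n % 8 = 5 ∨ n % 8 = 6 ∨ n % 8 = 7) →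
      (congruentNumberCurve n).analyticRank = 1 →
      Nat.card ((congruentNumberCurve n).selmerGroup 2) = 2 ^ 5 →
      Nat.card ((congruentNumberCurve n).selmerGroup 4) = 2 ^ 6 →
      ∀ L : ℤ, IsScriptL n L → (2 : ℤ) ∣ L ∧ ¬ (4 : ℤ) ∣ L := by
  intro n _ _ hsq h8 hr hSel2 hSel4
  by_cases hvis : (∃ l q : ℕ, l.Prime ∧ q.Prime ∧ l % 8 = 1 ∧ q % 8 = 7 ∧ IsSquare ((l : ℤ) : ZMod q) ∧ n = l * q) ∧
      ∃ (X Y : ℚ) (h : (Atwo n).toAffine.Nonsingular X Y),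
        (∀ P : (Atwo n).toAffine.Point, ∃ m : ℤ, IsOfFinAddOrder (P - m • (Point.some X Y h : (Atwo n).toAffine.Point))) ∧
          ¬ ∃ s : ℚ, X = 2 * s ^ 2
  · obtain ⟨⟨l, q, hl, hq, hl8, hq8, hlq, hn⟩, X, Y, h, hgen, hX⟩ := hvis
    exact SecondNormLawsValue.levelTwo_of_laws_visR2_value hB.1 hB.2.1 hB.2.2.2.1 hB.2.2.2.2.1 hT hl hq hl8 hq8 hn hr h hX hgen
      (hA l q n hl hq hl8 hq8 hlq hn hr) (hS hB l q n hl hq hl8 hq8 hlq hn hr hSel2 hSel4 ⟨X, Y, h, hgen, hX⟩)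
  · exact hO hB n hsq h8 hr hSel2 hSel4 hvis


end Summit.BirchSwinnertonDyer.PrintCf2.SecondNormLawsPrints

end
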